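import Summits.QuantumFields.YangMills.Theorems.AlphaInputsT3ACv3StartKnit
import HarnessLib

/-!
# `AlphaInputsT3ACv3StartShell` — START v3.1 for the (FL) `hLift` binder, row (S5)-4: **THE SHELL BOUND** — the binder `hshell` of `…v3StartT3.dist1_plaqHol_startT3_le` (stage (T)'s
# plaquettes on the boundary shell of every interior-vertex cube are `b_T`-flat) FROM stage (T)'s theorem `dist1_plaqHol_tubeSec_le` at the SHELL PREDICATE `ShellPlaq`, i.e. from the
# three lattice binders (hbox)∕(hsep)∕(hcov) of (S5)-4b restricted to shell plaquettes (displayed, for ★w2 g2 ∕ 19936-w8) — lane `pub-balaban3d` ∕ cell `ym3-torus`, seat `ym-ust-19936-w1`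
# (g2, LEAD)

WHY (bus PROGRESS 6 (ii), 04:55Z).  `…v3BallSystem` fills each vertex cube from the boundary data of stage (T) and needs `dist1 (plaqB (pullB v tubeSecΩ) u μ ν) ≤ b` on `BdryPlaq R u μ ν`;
read through the chart (`plaqHol_boxSite`) these are torus plaquettes of stage (T) with source `boxSite (vertexSite k y) u`, so stage (T)'s flatness theorem applies once its lattice
binders are known on them.  Orientation bookkeeping: `plaqB` with `μ = ν` is `1`, with `ν < μ` it is the inverse of the `(ν, μ)` plaquette.
WHAT IS HERE: `ShellPlaq` (def: the shell predicate), `plaqB_self`, `plaqB_swap_eq_inv`, `bdryPlaq_swap`, ★★`hshell_of_binders`.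
HONEST FRAMING.  Bookkeeping; the shell lattice binders are displayed, not proved; (FL)∕`hLift` NOT proved; count-neutral helper toward R3 2′ (items 19936∕19935); registry untouched;
nothing about d = 4, the continuum, or a mass gap; YM₃ on T³ is rung R3, not Clay.

References: T. Bałaban, Commun. Math. Phys. 102 (1985) 277–309 [Balaban1985Variational] ((11)–(14) pp.279–280); Commun. Math. Phys. 98 (1985) 17–51 [Balaban1985Averaging]
((9), (12) p.19).
-/

set_option autoImplicit false

noncomputable section

open scoped Matrix.Norms.L2Operator

namespace Summit.QuantumFields.YangMills.Theorems.TubeStart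

open Literature.MathematicalPhysics.QuantumFieldTheory.Balaban1983to89
open Literature.MathematicalPhysics.QuantumFieldTheory.Balaban1983to89.T4AdjointCovarianceUnitary (lieSU expSU)
open Literature.MathematicalPhysics.QuantumFieldTheory.Balaban1983to89.BlockAveragingSectionAction (iterSec)
open Literature.MathematicalPhysics.QuantumFieldTheory.Balaban1983to89.B10Eq38TorusDomains (toFine plaqsIn)
open Summit.QuantumFields.Balaban3D.Carriers
open Summit.QuantumFields.YangMills.Theorems.ModelBox

/-! ## §1 Orientation bookkeeping for model plaquettes -/

section Orient

variable {d : ℕ} {G : Type*} [Group G]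

/-- A degenerate model plaquette (`μ = ν`) is trivial. [folklore] -/
theorem plaqB_self (U : (Fin d → ℤ) → Fin d → G) (u : Fin d → ℤ) (μ : Fin d) : plaqB U u μ μ = 1 := by
  simp only [plaqB_def]; group

/-- Swapping the directions inverts the model plaquette. [cite: Balaban1985Averaging, (9) p.19] -/
theorem plaqB_swap_eq_inv (U : (Fin d → ℤ) → Fin d → G) (u : Fin d → ℤ) (μ ν : Fin d) : plaqB U u ν μ = (plaqB U u μ ν)⁻¹ := by
  simp only [plaqB_def, mul_inv_rev, inv_inv, mul_assoc]

/-- The boundary-plaquette predicate is symmetric in the two directions. [folklore] -/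
theorem bdryPlaq_swap {R : ℕ} {u : Fin d → ℤ} {μ ν : Fin d} (h : BdryPlaq R u μ ν) : BdryPlaq R u ν μ := by
  obtain ⟨⟨h1, h2, h3, h4⟩, i, hiμ, hiν, hi⟩ := h
  exact ⟨⟨h1, h3, h2, by rw [add_e_comm]; exact h4⟩, i, hiν, hiμ, hi⟩

end Orient

/-! ## §2 The shell bound from stage (T)'s lattice binders -/

section Shell

variable {P : Params} {n : Type*} [Fintype n] [DecidableEq n] [Nonempty n] (k : ℕ) (Ω : Set (Site P 0)) (V : GaugeField P k (Matrix.specialUnitaryGroup n ℂ))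

/-- **THE SHELL PREDICATE**: `q` is a boundary plaquette of the cube of half-side `R` around an interior vertex, read through the chart. [folklore] -/
def ShellPlaq (q : Plaq P 0) : Prop :=
  ∃ (y : Site P k) (u : Fin P.d → ℤ), IsInteriorVertex k Ω y ∧ BdryPlaq (RbT P k) u q.μ q.ν ∧ q.src = boxSite (vertexSite k y) u

/-- **★★ THE SHELL BOUND `hshell` FROM THE LATTICE BINDERS AT THE SHELL PREDICATE.** [cite: Balaban1985Variational, (11)–(14) pp.279–280] -/
theorem hshell_of_binders (hN : 2 * max (RtT P k) (P.L ^ k / 2) + 1 ≤ P.sitesPerDir 0) {bT : ℝ} (hbT : 0 ≤ bT)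
    (hbox : ∀ Q, IsTubeΩ k Ω Q → ∀ q : Plaq P 0, ShellPlaq k Ω q → (∃ b, Plaq.HasBond q b ∧ TubeActive V (RtT P k) (FpOf k V) (tfOf k Ω) (IsTubeΩ k Ω) Q b) →
      ∃ u : Fin P.d → ℤ, q.src = boxSite (cornerSite k Q.src Q.μ Q.ν) u ∧ InTube Q.μ Q.ν (RtT P k) (P.L ^ k / 2) u ∧ InTube Q.μ Q.ν (RtT P k) (P.L ^ k / 2) (u + e q.μ) ∧
        InTube Q.μ Q.ν (RtT P k) (P.L ^ k / 2) (u + e q.ν) ∧ InTube Q.μ Q.ν (RtT P k) (P.L ^ k / 2) (u + e q.μ + e q.ν))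
    (hsep : ∀ Q Q' (q : Plaq P 0), ShellPlaq k Ω q → (∃ b, Plaq.HasBond q b ∧ TubeActive V (RtT P k) (FpOf k V) (tfOf k Ω) (IsTubeΩ k Ω) Q b) →
      (∃ b, Plaq.HasBond q b ∧ TubeActive V (RtT P k) (FpOf k V) (tfOf k Ω) (IsTubeΩ k Ω) Q' b) → Q = Q')
    (hcov : ∀ q : Plaq P 0, ShellPlaq k Ω q → GaugeField.plaqHol (iterSec k V) q ≠ 1 → ∃ Q b, Plaq.HasBond q b ∧ TubeActive V (RtT P k) (FpOf k V) (tfOf k Ω) (IsTubeΩ k Ω) Q b)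
    (htube : ∀ Q, IsTubeΩ k Ω Q → ∀ (u : Fin P.d → ℤ) (α β : Fin P.d), Real.exp (|curlB (tfOf k Ω Q) u α β| * ‖((FpOf k V Q : lieSU n) : Matrix n n ℂ)‖) - 1 ≤ bT) :
    ∀ v, IsBallΩ k Ω v → ∀ (u : Fin P.d → ℤ) (μ ν : Fin P.d), BdryPlaq (RbT P k) u μ ν → GaugeGroup.dist1 (plaqB (pullB v (tubeSecΩ k Ω V)) u μ ν) ≤ bT := by
  -- the oriented case
  have main : ∀ (y : Site P k), IsInteriorVertex k Ω y → ∀ (u : Fin P.d → ℤ) (μ ν : Fin P.d) (hμν : μ < ν), BdryPlaq (RbT P k) u μ ν →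
      GaugeGroup.dist1 (plaqB (pullB (vertexSite k y) (tubeSecΩ k Ω V)) u μ ν) ≤ bT := by
    intro y hy u μ ν hμν hbp
    rw [← plaqHol_boxSite (vertexSite k y) (tubeSecΩ k Ω V) u hμν]
    exact dist1_plaqHol_tubeSec_le V (RtT P k) (FpOf k V) (tfOf k Ω) (IsTubeΩ k Ω) (ShellPlaq k Ω) hN hbT hbox hsep hcov htube _ ⟨y, u, hy, hbp, rfl⟩
  rintro v ⟨y, hy, rfl⟩ u μ ν hbp
  rcases lt_trichotomy μ ν with h | h | h
  · exact main y hy u μ ν h hbp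
  · subst h
    rw [plaqB_self, GaugeGroup.dist1_one]
    exact hbT
  · rw [plaqB_swap_eq_inv, GaugeGroup.dist1_inv]
    exact main y hy u ν μ h (bdryPlaq_swap hbp)

end Shell

end Summit.QuantumFields.YangMills.Theorems.TubeStart

end
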